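import Summits.Schanuel.Schanuel.Theorems.ZilberEacGraphNewtonBranch
import Summits.Schanuel.Schanuel.Theorems.ZilberEacGraphUnramifiedExamples
import HarnessLib

/-!
# The equimodular class, LV: a fibre curve ALL of whose zeros and poles are singular points — decided
# by a three-point Newton edge

HONEST FRAMING.  Cell `pub-schanuel` (Zilber's Exponential-Algebraic Closedness, case ladder;
host summit Schanuel), seat 2, gen 25.  An example outside files XLIV (unramified zero/pole) and LI
(simple root of `q₀` or `q_r`), and outside THEOREM EB (inseparable top row):
**`P = (x₀-1)²y₀³ - (x₀-1)(x₀+10)y₀² - x₀(x₀+7)y₀ + x₀²`** — top row `(X-1)²(X+1)`, `q₀ = x₀²`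
(double root, `q₁(0) = 0`), `q₃ = (x₀-1)²` (double root, `q₂(1) = 0`).  At `x₀ = 0` the Newton
diagram has the three-point edge `(0,2), (1,1), (2,0)` with edge polynomial `10w² - 7w + 1`, whose
roots `1/2, 1/5` are simple: `P(t, tw) = t²·(t(t-1)²w³ - (t-1)(t+10)w² - (t+7)w + 1)`, so file L
(`unprojectedDense_graph_newtonBranch`) gives **`unprojectedDensityQuestion_graph_threePointEdgeFibre`**:
for every `p` of degree `≥ 2`, `{x₁ = p(x₀), P = 0}` is in Mantova–Masser's case and has
Zariski-dense exponential points.  Irreducibility of `P` (quadratic in `x₀`) is by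
**`irreducible_quadratic_of_disc_ne_sq`** (coprime extreme coefficients and a non-square
discriminant, here `9y²(y+1)(17y+1)`).  Instances of an OPEN question (Mantova–Masser, PLMS 2024 §1
p. 5); EC(3,2) OPEN; NOT Schanuel's conjecture (neither used nor implied; EAC ⇏ SC).
-/

noncomputable section

open Filter Topology Set Complex MvPolynomial
open Literature.NumberTheory.Transcendental Literature.ModelTheory.Zilber
open Literature.ModelTheory.ExponentialFields

set_option linter.dupNamespace false

namespace Summit.Schanuel.Schanuel.Theorems

/-! ## Part A. Irreducibility of a quadratic with non-square discriminant -/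

/-- **`aX² + bX + c` is irreducible over a domain when `a, c` are coprime and `b² - 4ac` is not a
square.** [folklore] -/
theorem irreducible_quadratic_of_disc_ne_sq {R : Type*} [CommRing R] [IsDomain R] {a b c : R}
    (ha : a ≠ 0) (hac : IsCoprime a c) (hdisc : ∀ s : R, b ^ 2 - 4 * a * c ≠ s ^ 2) :
    Irreducible (Polynomial.C a * Polynomial.X ^ 2 + Polynomial.C b * Polynomial.X + Polynomial.C c) := by
  set q := Polynomial.C a * Polynomial.X ^ 2 + Polynomial.C b * Polynomial.X + Polynomial.C c with hq
  have hdeg : q.natDegree = 2 := Polynomial.natDegree_quadratic ha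
  have hq0 : q ≠ 0 := by intro h; rw [h, Polynomial.natDegree_zero] at hdeg; exact two_ne_zero hdeg.symm
  have hcoef : ∀ n, q.coeff n = if n = 2 then a else if n = 1 then b else if n = 0 then c else 0 := by
    intro n
    simp only [hq, Polynomial.coeff_add, Polynomial.coeff_C_mul, Polynomial.coeff_X_pow, Polynomial.coeff_X,
      Polynomial.coeff_C]
    rcases n with _ | _ | _ | n <;> simp
  -- a constant factor divides `a` and `c`, hence is a unit
  have key : ∀ f g : Polynomial R, q = f * g → f.natDegree = 0 → IsUnit f := by
    intro f g hfg hf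
    rw [Polynomial.eq_C_of_natDegree_eq_zero hf] at hfg ⊢
    refine Polynomial.isUnit_C.2 (hac.isUnit_of_dvd' ?_ ?_)
    · have h := (Polynomial.C_dvd_iff_dvd_coeff _ _).1 ⟨g, hfg⟩ 2
      rwa [hcoef] at h
    · have h := (Polynomial.C_dvd_iff_dvd_coeff _ _).1 ⟨g, hfg⟩ 0
      rwa [hcoef] at h
  refine ⟨fun hu => ?_, fun f g hfg => ?_⟩
  · have := Polynomial.natDegree_eq_zero_of_isUnit hu
    rw [hdeg] at this; exact two_ne_zero this
  · have hf0 : f ≠ 0 := fun h => hq0 (by rw [hfg, h, zero_mul])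
    have hg0 : g ≠ 0 := fun h => hq0 (by rw [hfg, h, mul_zero])
    have hsum : f.natDegree + g.natDegree = 2 := by
      rw [← Polynomial.natDegree_mul hf0 hg0, ← hfg, hdeg]
    by_cases hf : f.natDegree = 0
    · exact Or.inl (key f g hfg hf)
    by_cases hg : g.natDegree = 0
    · exact Or.inr (key g f (by rw [hfg, mul_comm]) hg)
    -- both factors linear: the discriminant is a square
    exfalso
    have hf1 : f.natDegree = 1 := by omega
    have hg1 : g.natDegree = 1 := by omega
    have hfe := Polynomial.eq_X_add_C_of_natDegree_le_one hf1.le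
    have hge := Polynomial.eq_X_add_C_of_natDegree_le_one hg1.le
    set f1 := f.coeff 1
    set f0 := f.coeff 0
    set g1 := g.coeff 1
    set g0 := g.coeff 0
    have hprod : f * g = Polynomial.C (f1 * g1) * Polynomial.X ^ 2 + Polynomial.C (f1 * g0 + f0 * g1) * Polynomial.X +
        Polynomial.C (f0 * g0) := by
      rw [hfe, hge]
      simp only [map_add, map_mul]
      ring
    have h2 : a = f1 * g1 := by
      have := congrArg (fun p : Polynomial R => p.coeff 2) (hfg.trans hprod)
      simp only [hcoef, Polynomial.coeff_add, Polynomial.coeff_C_mul, Polynomial.coeff_X_pow,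
        Polynomial.coeff_X, Polynomial.coeff_C] at this
      norm_num at this
      exact this
    have h1 : b = f1 * g0 + f0 * g1 := by
      have := congrArg (fun p : Polynomial R => p.coeff 1) (hfg.trans hprod)
      simp only [hcoef, Polynomial.coeff_add, Polynomial.coeff_C_mul, Polynomial.coeff_X_pow,
        Polynomial.coeff_X, Polynomial.coeff_C] at this
      norm_num at this
      exact this
    have h0 : c = f0 * g0 := by
      have := congrArg (fun p : Polynomial R => p.coeff 0) (hfg.trans hprod)
      simp only [hcoef, Polynomial.coeff_add, Polynomial.coeff_C_mul, Polynomial.coeff_X_pow,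
        Polynomial.coeff_X, Polynomial.coeff_C] at this
      norm_num at this
      exact this
    exact hdisc (f1 * g0 - f0 * g1) (by rw [h2, h1, h0]; ring)

/-! ## Part B. The example -/

/-- `(x₀-1)²y₀³ - (x₀-1)(x₀+10)y₀² - x₀(x₀+7)y₀ + x₀²` is irreducible. -/
theorem irreducible_threePointEdgeFibre :
    Irreducible ((X 0 - 1) ^ 2 * X 1 ^ 3 - (X 0 - 1) * (X 0 + 10) * X 1 ^ 2 - X 0 * (X 0 + 7) * X 1 + X 0 ^ 2 :
      MvPolynomial (Fin 2) ℂ) := by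
  classical
  set P : MvPolynomial (Fin 2) ℂ :=
    (X 0 - 1) ^ 2 * X 1 ^ 3 - (X 0 - 1) * (X 0 + 10) * X 1 ^ 2 - X 0 * (X 0 + 7) * X 1 + X 0 ^ 2 with hPdef
  -- as a quadratic in `x₀` with coefficients in `ℂ[y₀]`
  set A : Polynomial ℂ := Polynomial.X ^ 3 - Polynomial.X ^ 2 - Polynomial.X + 1 with hA
  set B : Polynomial ℂ := -2 * Polynomial.X ^ 3 - 9 * Polynomial.X ^ 2 - 7 * Polynomial.X with hB
  set Cc : Polynomial ℂ := Polynomial.X ^ 3 + 10 * Polynomial.X ^ 2 with hCc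
  set Q' : Polynomial (Polynomial ℂ) := Polynomial.C A * Polynomial.X ^ 2 + Polynomial.C B * Polynomial.X +
    Polynomial.C Cc with hQ'
  -- the swapped polynomial `P(y, x)`
  set Ps : MvPolynomial (Fin 2) ℂ := MvPolynomial.rename (Equiv.swap (0 : Fin 2) 1) P with hPs
  have hPsQ : ∀ x y : ℂ, MvPolynomial.eval ![x, y] Ps = (Q'.map (Polynomial.evalRingHom x)).eval y := by
    intro x y
    rw [hPs, MvPolynomial.eval_rename]
    have e : (![x, y] : Fin 2 → ℂ) ∘ (Equiv.swap (0 : Fin 2) 1) = ![y, x] := by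
      funext i; fin_cases i <;> rfl
    rw [e, hPdef, hQ']
    simp [hA, hB, hCc]
    ring
  -- `Q'` is irreducible
  have hA0 : A ≠ 0 := by
    intro h
    have := congrArg (fun q : Polynomial ℂ => q.eval 0) h
    simp [hA] at this
  have hAC : IsCoprime A Cc := by
    refine ⟨Polynomial.C (1 / 1089 : ℂ) * (1089 + 1089 * Polynomial.X + 98 * Polynomial.X ^ 2),
      Polynomial.C (1 / 1089 : ℂ) * (208 - 11 * Polynomial.X - 98 * Polynomial.X ^ 2), ?_⟩
    have h : (1089 + 1089 * Polynomial.X + 98 * Polynomial.X ^ 2) * A +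
        (208 - 11 * Polynomial.X - 98 * Polynomial.X ^ 2) * Cc = (1089 : Polynomial ℂ) := by
      rw [hA, hCc]; ring
    calc Polynomial.C (1 / 1089 : ℂ) * (1089 + 1089 * Polynomial.X + 98 * Polynomial.X ^ 2) * A +
          Polynomial.C (1 / 1089 : ℂ) * (208 - 11 * Polynomial.X - 98 * Polynomial.X ^ 2) * Cc
        = Polynomial.C (1 / 1089 : ℂ) * ((1089 + 1089 * Polynomial.X + 98 * Polynomial.X ^ 2) * A +
            (208 - 11 * Polynomial.X - 98 * Polynomial.X ^ 2) * Cc) := by ring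
      _ = 1 := by
          rw [h, show (1089 : Polynomial ℂ) = Polynomial.C 1089 from (map_ofNat Polynomial.C 1089).symm,
            ← map_mul]
          norm_num
  have hdisc : ∀ s : Polynomial ℂ, B ^ 2 - 4 * A * Cc ≠ s ^ 2 := by
    intro s hs
    have hD : B ^ 2 - 4 * A * Cc = 153 * Polynomial.X ^ 4 + 162 * Polynomial.X ^ 3 + 9 * Polynomial.X ^ 2 := by
      rw [hA, hB, hCc]; ring
    have hroot : (B ^ 2 - 4 * A * Cc).IsRoot (-1) := by
      rw [hD]; simp [Polynomial.IsRoot]; norm_num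
    have hder : ¬ (Polynomial.derivative (B ^ 2 - 4 * A * Cc)).IsRoot (-1) := by
      rw [hD]; simp [Polynomial.IsRoot, Polynomial.derivative_pow]; norm_num
    have hodd := odd_rootMultiplicity_of_simple_root hroot hder
    have h := sq_mul_ne_sq_of_odd_rootMultiplicity (P₁ := 1) (P₂ := s) hodd one_ne_zero
    rw [one_pow, mul_one] at h
    exact h hs
  have hQ'irr : Irreducible Q' := irreducible_quadratic_of_disc_ne_sq hA0 hAC hdisc
  have hPsirr : Irreducible Ps := (irreducible_rows_iff hPsQ).2 hQ'irr
  have : Ps = MvPolynomial.renameEquiv ℂ (Equiv.swap (0 : Fin 2) 1) P := rfl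
  rw [this] at hPsirr
  exact (MulEquiv.irreducible_iff (MvPolynomial.renameEquiv ℂ (Equiv.swap (0 : Fin 2) 1))).1 hPsirr

/-- **`{x₁ = p(x₀), (x₀-1)²y₀³ - (x₀-1)(x₀+10)y₀² - x₀(x₀+7)y₀ + x₀² = 0}` is in Mantova–Masser's case
and DENSE** for every `p` of degree `≥ 2` (top row `(X-1)²(X+1)`, `θ = -1`; three-point Newton edge
at `x₀ = 0`: `x₀ = t`, `y₀ = t w`, `Q̃ = t(t-1)²w³ - (t-1)(t+10)w² - (t+7)w + 1`, `w₀ = 1/2`).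
[cite: MantovaMasser2023, §1 Further remarks, p. 5 (the question, open in general)] (new) -/
theorem unprojectedDensityQuestion_graph_threePointEdgeFibre (p : Polynomial ℂ) (hd : 2 ≤ p.natDegree) :
    MMCaseDimPiOneFree {w : Fin 2 ⊕ Fin 2 → ℂ | w (Sum.inl 1) = p.eval (w (Sum.inl 0)) ∧
      (w (Sum.inl 0) - 1) ^ 2 * w (Sum.inr 0) ^ 3 - (w (Sum.inl 0) - 1) * (w (Sum.inl 0) + 10) * w (Sum.inr 0) ^ 2 -
        w (Sum.inl 0) * (w (Sum.inl 0) + 7) * w (Sum.inr 0) + w (Sum.inl 0) ^ 2 = 0} ∧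
    UnprojectedDense {w : Fin 2 ⊕ Fin 2 → ℂ | w (Sum.inl 1) = p.eval (w (Sum.inl 0)) ∧
      (w (Sum.inl 0) - 1) ^ 2 * w (Sum.inr 0) ^ 3 - (w (Sum.inl 0) - 1) * (w (Sum.inl 0) + 10) * w (Sum.inr 0) ^ 2 -
        w (Sum.inl 0) * (w (Sum.inl 0) + 7) * w (Sum.inr 0) + w (Sum.inl 0) ^ 2 = 0} := by
  classical
  set P : MvPolynomial (Fin 2) ℂ :=
    (X 0 - 1) ^ 2 * X 1 ^ 3 - (X 0 - 1) * (X 0 + 10) * X 1 ^ 2 - X 0 * (X 0 + 7) * X 1 + X 0 ^ 2 with hPdef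
  have hset : {w : Fin 2 ⊕ Fin 2 → ℂ | w (Sum.inl 1) = p.eval (w (Sum.inl 0)) ∧
      (w (Sum.inl 0) - 1) ^ 2 * w (Sum.inr 0) ^ 3 - (w (Sum.inl 0) - 1) * (w (Sum.inl 0) + 10) * w (Sum.inr 0) ^ 2 -
        w (Sum.inl 0) * (w (Sum.inl 0) + 7) * w (Sum.inr 0) + w (Sum.inl 0) ^ 2 = 0} =
      {w : Fin 2 ⊕ Fin 2 → ℂ | w (Sum.inl 1) = p.eval (w (Sum.inl 0)) ∧
        MvPolynomial.eval ![w (Sum.inl 0), w (Sum.inr 0)] P = 0} := by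
    ext w
    simp only [Set.mem_setOf_eq, hPdef, MvPolynomial.eval_X, map_add, map_sub, map_mul, map_pow, map_one,
      map_ofNat, Matrix.cons_val_zero, Matrix.cons_val_one]
  rw [hset]
  have hirr : Irreducible P := irreducible_threePointEdgeFibre
  -- the rows, in expanded form
  set q₃ : Polynomial ℂ := Polynomial.C 1 * Polynomial.X ^ 2 + Polynomial.C (-2) * Polynomial.X + Polynomial.C 1
    with hq₃
  set q₂ : Polynomial ℂ := Polynomial.C (-1) * Polynomial.X ^ 2 + Polynomial.C (-9) * Polynomial.X + Polynomial.C 10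
    with hq₂
  set q₁ : Polynomial ℂ := Polynomial.C (-1) * Polynomial.X ^ 2 + Polynomial.C (-7) * Polynomial.X + Polynomial.C 0
    with hq₁
  set q₀ : Polynomial ℂ := Polynomial.C 1 * Polynomial.X ^ 2 + Polynomial.C 0 * Polynomial.X + Polynomial.C 0
    with hq₀
  set Q : Polynomial (Polynomial ℂ) := Polynomial.C q₃ * Polynomial.X ^ 3 + Polynomial.C q₂ * Polynomial.X ^ 2 +
    Polynomial.C q₁ * Polynomial.X + Polynomial.C q₀ with hQ
  have hP : ∀ x y : ℂ, MvPolynomial.eval ![x, y] P = (Q.map (Polynomial.evalRingHom x)).eval y := by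
    intro x y
    simp [hPdef, hQ, hq₃, hq₂, hq₁, hq₀]
    ring
  have hcoefQ : ∀ j, Q.coeff j = if j = 3 then q₃ else if j = 2 then q₂ else if j = 1 then q₁
      else if j = 0 then q₀ else 0 := fun j => coeff_cubicRows q₀ q₁ q₂ q₃ j
  have hquad : ∀ a b c : ℂ, (Polynomial.C a * Polynomial.X ^ 2 + Polynomial.C b * Polynomial.X + Polynomial.C c).natDegree ≤ 2 :=
    fun a b c => Polynomial.natDegree_quadratic_le
  have hquad2 : ∀ a b c : ℂ, (Polynomial.C a * Polynomial.X ^ 2 + Polynomial.C b * Polynomial.X + Polynomial.C c).coeff 2 = a := by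
    intro a b c
    simp
  have hN : ∀ j, (Q.coeff j).natDegree ≤ 2 := by
    intro j
    rw [hcoefQ]
    split_ifs
    · exact hquad _ _ _
    · exact hquad _ _ _
    · exact hquad _ _ _
    · exact hquad _ _ _
    · simp
  set T : Polynomial ℂ := Polynomial.C 1 * Polynomial.X ^ 3 + Polynomial.C (-1) * Polynomial.X ^ 2 +
    Polynomial.C (-1) * Polynomial.X + Polynomial.C 1 with hTdef
  have hcoefT : ∀ j, T.coeff j = if j = 3 then (1 : ℂ) else if j = 2 then -1 else if j = 1 then -1
      else if j = 0 then 1 else 0 := by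
    intro j
    simp only [hTdef, Polynomial.coeff_add, Polynomial.coeff_C_mul, Polynomial.coeff_X_pow, Polynomial.coeff_X,
      Polynomial.coeff_C]
    rcases j with _ | _ | _ | _ | j <;> simp
  have hT : ∀ j, T.coeff j = (Q.coeff j).coeff 2 := by
    intro j
    rw [hcoefQ, hcoefT]
    by_cases h3 : j = 3
    · rw [if_pos h3, if_pos h3, hq₃, hquad2]
    rw [if_neg h3, if_neg h3]
    by_cases h2 : j = 2
    · rw [if_pos h2, if_pos h2, hq₂, hquad2]
    rw [if_neg h2, if_neg h2]
    by_cases h1 : j = 1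
    · rw [if_pos h1, if_pos h1, hq₁, hquad2]
    rw [if_neg h1, if_neg h1]
    by_cases h0 : j = 0
    · rw [if_pos h0, if_pos h0, hq₀, hquad2]
    rw [if_neg h0, if_neg h0, Polynomial.coeff_zero]
  have hT0 : T ≠ 0 := by
    intro h
    have := congrArg (fun q : Polynomial ℂ => q.eval 0) h
    simp [hTdef] at this
  refine ⟨mmCase_fibreCurveSurface p hd hirr ?_, ?_⟩
  · -- every `t ∉ {0, 1}` has a nonzero fibre point
    refine ((Set.finite_singleton (0 : ℂ)).insert 1).infinite_compl.mono ?_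
    intro t ht
    simp only [Set.mem_compl_iff, Set.mem_insert_iff, Set.mem_singleton_iff, not_or] at ht
    set q : Polynomial ℂ := Polynomial.C ((t - 1) ^ 2) * Polynomial.X ^ 3 + Polynomial.C (-((t - 1) * (t + 10))) *
      Polynomial.X ^ 2 + Polynomial.C (-(t * (t + 7))) * Polynomial.X + Polynomial.C (t ^ 2) with hq
    have hqdeg : 0 < q.degree := by
      rw [hq, Polynomial.degree_cubic (pow_ne_zero 2 (sub_ne_zero.2 ht.1))]; norm_num
    obtain ⟨y, hy⟩ := Complex.exists_root hqdeg
    have hy' : (t - 1) ^ 2 * y ^ 3 - (t - 1) * (t + 10) * y ^ 2 - t * (t + 7) * y + t ^ 2 = 0 := by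
      have := hy.eq_zero
      simp only [hq, Polynomial.eval_add, Polynomial.eval_mul, Polynomial.eval_C, Polynomial.eval_pow,
        Polynomial.eval_X] at this
      linear_combination this
    refine ⟨y, ?_, ?_⟩
    · rintro rfl
      apply ht.2
      have : t ^ 2 = 0 := by linear_combination hy'
      exact pow_eq_zero_iff (n := 2) (by norm_num) |>.1 this
    · simp only [hPdef, map_add, map_sub, map_mul, map_pow, map_one, map_ofNat, MvPolynomial.eval_X,
        Matrix.cons_val_zero, Matrix.cons_val_one]
      exact hy'
  · refine unprojectedDense_graph_newtonBranch Q hP hirr 2 hN T hT hT0 (θ := -1) (by norm_num) ?_ ?_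
      0 (e := 1) (μ := 1) (ν := 2) le_rfl le_rfl
      (Polynomial.C ((Polynomial.X - 1) ^ 2 * Polynomial.X) * Polynomial.X ^ 3 -
        Polynomial.C ((Polynomial.X - 1) * (Polynomial.X + 10)) * Polynomial.X ^ 2 -
        Polynomial.C (Polynomial.X + 7) * Polynomial.X + 1)
      (w₀ := 1 / 2) (by norm_num) ?_ ?_ (Or.inl fun t w _ _ => ?_) p hd
    · simp [hTdef]; norm_num
    · simp [hTdef]; norm_num
    · simp; norm_num
    · simp [Polynomial.derivative_mul, Polynomial.derivative_pow]; norm_num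
    · simp [hQ, hq₃, hq₂, hq₁, hq₀]
      ring

end Summit.Schanuel.Schanuel.Theorems
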